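import Summits.QuantumFields.BalabanUV.Beta.EriceFlowEnclosureB12AsPrintedHistoryContagionShiftFlowZeroTangentSmooth
import Summits.QuantumFields.BalabanUV.Beta.EriceFlowEnclosureB12AsPrintedHistoryContagionShiftFlowZeroSemigroupGellMannLowSmooth

/-!
# Beta / EriceFlowEnclosureB12AsPrintedHistoryContagionShiftFlowZeroTangentGellMannLow — ASYMPTOTIC FREEDOM IS CONTAGIOUS, part 72: THE GELL-MANN–LOW EQUATION AT EVERY
# SCALE, WITH A CONTINUOUS β-FUNCTION.  Part 60 (#73g) was the ABSTRACT smooth theory of the continuous renormalization group `φ_s = Λ⁻¹∘(Λ + sβ₀)` under the hypothesis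
# `hD : ∀ x ∈ ]0, e′[, HasDerivAt Λ (D x) x`; parts 70–71 DISCHARGED `hD` FOR THE FLOW with `D = deriv Λ`, continuous, under part 68's C¹ shape of the memory functional
# (`hG` gradient profile, `hGB` uniform remainder, `hGc` continuity of the gradient).  This file READS part 60 on the flow (part 14's package at e′; Λ any dynamical Abel
# function, strictly antitone onto `[Λ e′, ∞[`; β₀ > 0): (§123) **`∂_s φ_s g = β₀ ∕ deriv Λ (φ_s g)` AT EVERY SCALE** with `Λ e′ < Λ g + sβ₀` (`rg_hasDerivAt_flow`) — the
# Gell-Mann–Low ordinary differential equation of the flow with memory holds EVERYWHERE, not almost everywhere (gen 41's #73c∕#73e); its right-hand side is part 57's ONE-LOOP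
# velocity `−(β₀∕2)x³(1 ± (3∕2)κx)` at every such scale (`rg_velocity_oneLoop_flow`); the pin-derivative `∂_g φ_s g = Λ′(g)∕Λ′(φ_s g)` and the linear RG (transport) equation
# hold everywhere (`rg_hasDerivAt_pin_flow`); RG time is the integral of the continuous inverse generator `s = ∫_{φ_s g}^{g} (−Λ′∕β₀)`
# (`rg_time_integral_flow`); (§124) the velocity is CONTINUOUS in the scale and **the running coupling `s ↦ φ_s g` is C¹ on ]0, ∞[** (`rg_contDiffOn_flow`); THE β-FUNCTION
# **`β_c := β₀∕Λ′` IS CONTINUOUS ON ]0, e′[ with `|(−2∕(β₀x³))·β_c(x) − 1| ≤ (4∕3)·C_m(8x³ + 16x∕β*)∕(1−θ)` AT EVERY COUPLING** (`betaFunction_continuous_oneLoop`) — a continuous,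
# asymptotically free generator.  Readings only: «Gell-Mann–Low ∕ β_c» name OUR objects (β-flow team, prover 1, unit `b2b-balaban-beta-bflow-p1`, gen 42; ROW AP-I·Uc × NODE U2)

HONEST FRAMING (page 1 of everything the β sub-cell writes): discharging `BetaPertH` makes Bałaban's UV stability UNCONDITIONAL — a
real constructive-QFT result; it is NOT the continuum limit and NOT the Clay problem.  HONEST DEPENDENCY (cell reorg 2026-08-19,
verbatim): «continuum YM on T⁴ ⇐ BetaPertH ∧ nine spine estimates (0/9 proved); BetaPertH ⇐ (D1) ∧ (D4) ∧ CAP+tail; G-an2-4 gates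
asym, D1 and NE2/3/4.»  THIS MODULE DISCHARGES NOTHING: junctions BY NAME of parts 57, 60, 70, 71 (no new analysis beyond one `1∕(1+u)` estimate) over node U2's HYPOTHESIS
SHAPES consumed BY NAME (NOT PRINTED for [I] = T. Bałaban, Commun. Math. Phys. **109** (1987) [Balaban1987RG1]: p. 298, (0.20) p. 256, Theorem 2 (0.31) p. 259 STATED
WITHOUT PROOF; Erice 1985 (3.61)–(3.62) p. 250 differentiate the CONTINUUM coupling in the scale — a reading, not asserted).  The C¹ shape is OUR explicit binder.  Nothing of
Bałaban's β is asserted.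

WHAT THIS FILE PROVES (0 sorry, 0 def): §123 **`rg_hasDerivAt_flow`**, **`rg_velocity_oneLoop_flow`**, `rg_hasDerivAt_pin_flow` (with the transport equation), `rg_time_integral_flow`;
§124 **`rg_velocity_continuousOn_flow`**, **`rg_contDiffOn_flow`**, `abs_inv_one_add_sub_one_le`, **`betaFunction_continuous_oneLoop`**.  NOT CLAIMED: anything about Bałaban's β;
`BetaPertH`; the continuum limit of the measures; Clay.
-/

namespace Summit.QuantumFields.BalabanUV.Beta.EriceFlowEnclosureB12AsPrintedHistoryContagionShiftFlowZeroTangentGellMannLow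

open Finset Filter Topology Set Function MeasureTheory intervalIntegral
open Literature.MathematicalPhysics.QuantumFieldTheory.Balaban1983to89
open Literature.MathematicalPhysics.QuantumFieldTheory.Balaban1983to89.T4BetaStationary (SeqBox MemoryProfile)
open Literature.MathematicalPhysics.QuantumFieldTheory.Balaban1983to89.T4BetaFlowWellPosed (MemFlow solution)
open Summit.QuantumFields.BalabanUV.Beta.EriceFlowEnclosureB12AsPrintedHistoryContagionShiftFlowZeroSemigroupBackward (rg_mem_eq_of_le)
open Summit.QuantumFields.BalabanUV.Beta.EriceFlowEnclosureB12AsPrintedHistoryContagionShiftFlowZeroSemigroupGellMannLowOneLoop (dynAbel_chart_bounds velocity_oneLoop)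
open Summit.QuantumFields.BalabanUV.Beta.EriceFlowEnclosureB12AsPrintedHistoryContagionShiftFlowZeroSemigroupGellMannLowSmooth (rg_hasDerivAt rg_deriv_eq
  rg_differentiableOn rg_hasDerivAt_pin rg_transport_everywhere rg_velocity_continuousOn rg_time_eq_integral_generator)
open Summit.QuantumFields.BalabanUV.Beta.EriceFlowEnclosureB12AsPrintedHistoryContagionShiftFlowZeroTangentLambda (differentiableAt_dynAbel differentiableOn_dynAbel)
open Summit.QuantumFields.BalabanUV.Beta.EriceFlowEnclosureB12AsPrintedHistoryContagionShiftFlowZeroTangentSmooth (deriv_dynAbel_continuousOn smooth_hypotheses_of_flow)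

noncomputable section

/-! ## §123 The Gell-Mann–Low equation of the flow with memory at every scale -/

/-- **THE GELL-MANN–LOW EQUATION AT EVERY SCALE.**  Part 14's package at e′; part 68's C¹ shape (`hG`, `hGB`); Λ a dynamical Abel function of the flow (part 44's interface),
strictly antitone on ]0, e′] onto `[Λ e′, ∞[`; β₀ > 0.  THEN at EVERY scale s with `Λ e′ < Λ g + sβ₀` (the running coupling interior):
**`HasDerivAt (σ ↦ φ_σ g) (β₀ ∕ deriv Λ (φ_s g)) s`**, `φ_σ g = Λ⁻¹(Λ g + σβ₀)` — part 60's ODE with its derivative hypothesis DISCHARGED by part 70.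
[cite: Balaban1987RG1, Thm 2 (0.31) p.259 with (0.20) p.256 and p.298] -/
theorem rg_hasDerivAt_flow {B : (ℕ → ℝ) → ℝ} {G : (ℕ → ℝ) → ℕ → ℝ} {Cm θ γ β₀ bs ta gs e' : ℝ} {t : ℕ → ℝ} {a : ℕ → ℝ} {Λ : ℝ → ℝ}
    (hB : MemoryProfile Cm θ γ B) (hCm : 0 ≤ Cm) (hθ0 : 0 ≤ θ) (hθ1 : θ < 1) (hbs : 0 < bs) (hta : 0 < ta)
    (hts : SeqBox γ t) (htf : MemFlow B gs t) (hprof : ∀ m : ℕ, 1 / ta ^ 2 + bs * (m : ℝ) ≤ 1 / (t m) ^ 2)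
    (hG : ∀ u : ℕ → ℝ, SeqBox γ u → ∀ j, |G u j| ≤ Cm * θ ^ j)
    (hGB : ∀ ε > 0, ∃ ρ > 0, ∀ u u' : ℕ → ℝ, SeqBox γ u → SeqBox γ u' → (∀ j, |u' j - u j| ≤ ρ) →
      |B u' - B u - ∑' j, G u j * (u' j - u j)| ≤ ε * ∑' j, θ ^ j * |u' j - u j|)
    (hΛ : ∀ e ∈ Ioc (0 : ℝ) e', ∀ h : ℕ → ℝ, SeqBox γ h → MemFlow B e h → Tendsto (fun n => 1 / h n ^ 2 - a n) atTop (𝓝 (Λ e)))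
    (hanti : StrictAntiOn Λ (Ioc 0 e')) (honto : ∀ y : ℝ, Λ e' ≤ y → ∃ x ∈ Ioc (0 : ℝ) e', Λ x = y) (hβ₀ : 0 < β₀)
    (h2e' : 2 * e' ≤ γ) (hs1 : 4 * Cm * e' ≤ bs * (1 - θ))
    (hs2 : e' ^ 2 * (1 / gs ^ 2 + Cm * γ / (1 - θ) ^ 2 + (2 * Cm / ((1 - θ) * bs)) ^ 2) ≤ 3 / 4)
    (hs4 : 64 * Cm * e' ^ 3 ≤ (1 - θ) ^ 2) (hs5 : Cm * (8 * e' ^ 3 + 16 * e' / bs) ≤ (1 - θ) / 4)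
    {g s : ℝ} (hgs : Λ e' < Λ g + s * β₀) :
    HasDerivAt (fun σ : ℝ => invFunOn Λ (Ioc 0 e') (Λ g + σ * β₀)) (β₀ / deriv Λ (invFunOn Λ (Ioc 0 e') (Λ g + s * β₀))) s :=
  rg_hasDerivAt (D := deriv Λ) hanti honto hβ₀ (dynAbel_chart_bounds hB hCm hθ0 hθ1 hbs hta hts htf hprof hΛ h2e' hs1 hs2 hs4 hs5)
    (differentiableOn_dynAbel hB hCm hθ0 hθ1 hbs hta hts htf hprof hG hGB hΛ h2e' hs1 hs2 hs4 hs5).2 hgs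

/-- **THE VELOCITY IS ONE-LOOP AT EVERY SCALE**: with `x = φ_s g` interior and `V = β₀∕Λ′(x)` the velocity of §123,
`−(β₀∕2)x³∕(1−κx) ≤ V ≤ −(β₀∕2)x³∕(1+κx)` and `|(−2∕(β₀x³))·V − 1| ≤ (3∕2)κx`, κ = 64C_m∕(3(1−θ)β*) — part 57's law wherever a velocity exists, and now one exists at every scale.
[cite: Balaban1987RG1, Thm 2 (0.31) p.259 with (0.20) p.256 and p.298] -/
theorem rg_velocity_oneLoop_flow {B : (ℕ → ℝ) → ℝ} {G : (ℕ → ℝ) → ℕ → ℝ} {Cm θ γ β₀ bs ta gs e' : ℝ} {t : ℕ → ℝ} {a : ℕ → ℝ} {Λ : ℝ → ℝ}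
    (hB : MemoryProfile Cm θ γ B) (hCm : 0 ≤ Cm) (hθ0 : 0 ≤ θ) (hθ1 : θ < 1) (hbs : 0 < bs) (hta : 0 < ta)
    (hts : SeqBox γ t) (htf : MemFlow B gs t) (hprof : ∀ m : ℕ, 1 / ta ^ 2 + bs * (m : ℝ) ≤ 1 / (t m) ^ 2)
    (hG : ∀ u : ℕ → ℝ, SeqBox γ u → ∀ j, |G u j| ≤ Cm * θ ^ j)
    (hGB : ∀ ε > 0, ∃ ρ > 0, ∀ u u' : ℕ → ℝ, SeqBox γ u → SeqBox γ u' → (∀ j, |u' j - u j| ≤ ρ) →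
      |B u' - B u - ∑' j, G u j * (u' j - u j)| ≤ ε * ∑' j, θ ^ j * |u' j - u j|)
    (hΛ : ∀ e ∈ Ioc (0 : ℝ) e', ∀ h : ℕ → ℝ, SeqBox γ h → MemFlow B e h → Tendsto (fun n => 1 / h n ^ 2 - a n) atTop (𝓝 (Λ e)))
    (hanti : StrictAntiOn Λ (Ioc 0 e')) (honto : ∀ y : ℝ, Λ e' ≤ y → ∃ x ∈ Ioc (0 : ℝ) e', Λ x = y) (hβ₀ : 0 < β₀)
    (h2e' : 2 * e' ≤ γ) (hs1 : 4 * Cm * e' ≤ bs * (1 - θ))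
    (hs2 : e' ^ 2 * (1 / gs ^ 2 + Cm * γ / (1 - θ) ^ 2 + (2 * Cm / ((1 - θ) * bs)) ^ 2) ≤ 3 / 4)
    (hs4 : 64 * Cm * e' ^ 3 ≤ (1 - θ) ^ 2) (hs5 : Cm * (8 * e' ^ 3 + 16 * e' / bs) ≤ (1 - θ) / 4)
    {g s : ℝ} (hgs : Λ e' < Λ g + s * β₀) :
    -(β₀ / 2) * invFunOn Λ (Ioc 0 e') (Λ g + s * β₀) ^ 3 / (1 - 64 * Cm / (3 * (1 - θ) * bs) * invFunOn Λ (Ioc 0 e') (Λ g + s * β₀))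
        ≤ β₀ / deriv Λ (invFunOn Λ (Ioc 0 e') (Λ g + s * β₀)) ∧
      β₀ / deriv Λ (invFunOn Λ (Ioc 0 e') (Λ g + s * β₀))
        ≤ -(β₀ / 2) * invFunOn Λ (Ioc 0 e') (Λ g + s * β₀) ^ 3 / (1 + 64 * Cm / (3 * (1 - θ) * bs) * invFunOn Λ (Ioc 0 e') (Λ g + s * β₀)) ∧
      |-2 / (β₀ * invFunOn Λ (Ioc 0 e') (Λ g + s * β₀) ^ 3) * (β₀ / deriv Λ (invFunOn Λ (Ioc 0 e') (Λ g + s * β₀))) - 1|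
        ≤ 3 / 2 * (64 * Cm / (3 * (1 - θ) * bs)) * invFunOn Λ (Ioc 0 e') (Λ g + s * β₀) :=
  velocity_oneLoop hB hCm hθ0 hθ1 hbs hta hts htf hprof hΛ hanti honto hβ₀ h2e' hs1 hs2 hs4 hs5 hgs
    (rg_hasDerivAt_flow hB hCm hθ0 hθ1 hbs hta hts htf hprof hG hGB hΛ hanti honto hβ₀ h2e' hs1 hs2 hs4 hs5 hgs)

/-- **THE PIN-DERIVATIVE OF THE CONTINUOUS RG AT EVERY SCALE**: `∂_g φ_s g = Λ′(g)∕Λ′(φ_s g)` for interior g and `Λ e′ < Λ g + sβ₀` — the classical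
`∂g(s)∕∂g(0) = β(g(s))∕β(g(0))`, everywhere. [cite: Balaban1987RG1, Thm 2 (0.31) p.259 with (0.20) p.256 and p.298] -/
theorem rg_hasDerivAt_pin_flow {B : (ℕ → ℝ) → ℝ} {G : (ℕ → ℝ) → ℕ → ℝ} {Cm θ γ β₀ bs ta gs e' : ℝ} {t : ℕ → ℝ} {a : ℕ → ℝ} {Λ : ℝ → ℝ}
    (hB : MemoryProfile Cm θ γ B) (hCm : 0 ≤ Cm) (hθ0 : 0 ≤ θ) (hθ1 : θ < 1) (hbs : 0 < bs) (hta : 0 < ta)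
    (hts : SeqBox γ t) (htf : MemFlow B gs t) (hprof : ∀ m : ℕ, 1 / ta ^ 2 + bs * (m : ℝ) ≤ 1 / (t m) ^ 2)
    (hG : ∀ u : ℕ → ℝ, SeqBox γ u → ∀ j, |G u j| ≤ Cm * θ ^ j)
    (hGB : ∀ ε > 0, ∃ ρ > 0, ∀ u u' : ℕ → ℝ, SeqBox γ u → SeqBox γ u' → (∀ j, |u' j - u j| ≤ ρ) →
      |B u' - B u - ∑' j, G u j * (u' j - u j)| ≤ ε * ∑' j, θ ^ j * |u' j - u j|)
    (hΛ : ∀ e ∈ Ioc (0 : ℝ) e', ∀ h : ℕ → ℝ, SeqBox γ h → MemFlow B e h → Tendsto (fun n => 1 / h n ^ 2 - a n) atTop (𝓝 (Λ e)))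
    (hanti : StrictAntiOn Λ (Ioc 0 e')) (honto : ∀ y : ℝ, Λ e' ≤ y → ∃ x ∈ Ioc (0 : ℝ) e', Λ x = y) (hβ₀ : 0 < β₀)
    (h2e' : 2 * e' ≤ γ) (hs1 : 4 * Cm * e' ≤ bs * (1 - θ))
    (hs2 : e' ^ 2 * (1 / gs ^ 2 + Cm * γ / (1 - θ) ^ 2 + (2 * Cm / ((1 - θ) * bs)) ^ 2) ≤ 3 / 4)
    (hs4 : 64 * Cm * e' ^ 3 ≤ (1 - θ) ^ 2) (hs5 : Cm * (8 * e' ^ 3 + 16 * e' / bs) ≤ (1 - θ) / 4)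
    {g s : ℝ} (hg : g ∈ Ioo (0 : ℝ) e') (hgs : Λ e' < Λ g + s * β₀) :
    HasDerivAt (fun g' : ℝ => invFunOn Λ (Ioc 0 e') (Λ g' + s * β₀)) (deriv Λ g / deriv Λ (invFunOn Λ (Ioc 0 e') (Λ g + s * β₀))) g ∧
      deriv (fun σ : ℝ => invFunOn Λ (Ioc 0 e') (Λ g + σ * β₀)) s
        = β₀ / deriv Λ g * deriv (fun g' : ℝ => invFunOn Λ (Ioc 0 e') (Λ g' + s * β₀)) g := by
  have hb := dynAbel_chart_bounds hB hCm hθ0 hθ1 hbs hta hts htf hprof hΛ h2e' hs1 hs2 hs4 hs5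
  have hD := (differentiableOn_dynAbel hB hCm hθ0 hθ1 hbs hta hts htf hprof hG hGB hΛ h2e' hs1 hs2 hs4 hs5).2
  exact ⟨rg_hasDerivAt_pin (D := deriv Λ) hanti honto hβ₀ hb hD hg hgs, rg_transport_everywhere (D := deriv Λ) hanti honto hβ₀ hb hD hg hgs⟩

/-- **RG TIME IS THE INTEGRAL OF THE CONTINUOUS INVERSE GENERATOR**: `s = ∫_{φ_s g}^{g} (−Λ′(x)∕β₀) dx` for interior g and s ≥ 0, with `Λ′ = deriv Λ` a genuine (continuous)
derivative. [cite: Balaban1987RG1, Thm 2 (0.31) p.259 with (0.20) p.256 and p.298] -/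
theorem rg_time_integral_flow {B : (ℕ → ℝ) → ℝ} {G : (ℕ → ℝ) → ℕ → ℝ} {Cm θ γ β₀ bs ta gs e' : ℝ} {t : ℕ → ℝ} {a : ℕ → ℝ} {Λ : ℝ → ℝ}
    (hB : MemoryProfile Cm θ γ B) (hCm : 0 ≤ Cm) (hθ0 : 0 ≤ θ) (hθ1 : θ < 1) (hbs : 0 < bs) (hta : 0 < ta)
    (hts : SeqBox γ t) (htf : MemFlow B gs t) (hprof : ∀ m : ℕ, 1 / ta ^ 2 + bs * (m : ℝ) ≤ 1 / (t m) ^ 2)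
    (hG : ∀ u : ℕ → ℝ, SeqBox γ u → ∀ j, |G u j| ≤ Cm * θ ^ j)
    (hGB : ∀ ε > 0, ∃ ρ > 0, ∀ u u' : ℕ → ℝ, SeqBox γ u → SeqBox γ u' → (∀ j, |u' j - u j| ≤ ρ) →
      |B u' - B u - ∑' j, G u j * (u' j - u j)| ≤ ε * ∑' j, θ ^ j * |u' j - u j|)
    (hΛ : ∀ e ∈ Ioc (0 : ℝ) e', ∀ h : ℕ → ℝ, SeqBox γ h → MemFlow B e h → Tendsto (fun n => 1 / h n ^ 2 - a n) atTop (𝓝 (Λ e)))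
    (hanti : StrictAntiOn Λ (Ioc 0 e')) (honto : ∀ y : ℝ, Λ e' ≤ y → ∃ x ∈ Ioc (0 : ℝ) e', Λ x = y) (hβ₀ : 0 < β₀)
    (h2e' : 2 * e' ≤ γ) (hs1 : 4 * Cm * e' ≤ bs * (1 - θ))
    (hs2 : e' ^ 2 * (1 / gs ^ 2 + Cm * γ / (1 - θ) ^ 2 + (2 * Cm / ((1 - θ) * bs)) ^ 2) ≤ 3 / 4)
    (hs4 : 64 * Cm * e' ^ 3 ≤ (1 - θ) ^ 2) (hs5 : Cm * (8 * e' ^ 3 + 16 * e' / bs) ≤ (1 - θ) / 4)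
    {g s : ℝ} (hg : g ∈ Ioo (0 : ℝ) e') (hs : 0 ≤ s) :
    s = ∫ x in invFunOn Λ (Ioc 0 e') (Λ g + s * β₀)..g, -deriv Λ x / β₀ :=
  rg_time_eq_integral_generator (D := deriv Λ) hanti honto hβ₀ (dynAbel_chart_bounds hB hCm hθ0 hθ1 hbs hta hts htf hprof hΛ h2e' hs1 hs2 hs4 hs5)
    (differentiableOn_dynAbel hB hCm hθ0 hθ1 hbs hta hts htf hprof hG hGB hΛ h2e' hs1 hs2 hs4 hs5).2 hg hs

/-! ## §124 Continuity of the velocity; the running coupling is C¹ in the scale; a continuous β-function -/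

/-- **THE VELOCITY IS CONTINUOUS IN THE SCALE** (under the continuity letter `hGc` of the gradient): `s ↦ β₀∕Λ′(φ_s g)` is continuous on ]0, ∞[ for every pin g of
]0, e′]. [cite: Balaban1987RG1, Thm 2 (0.31) p.259 with (0.20) p.256 and p.298] -/
theorem rg_velocity_continuousOn_flow {B : (ℕ → ℝ) → ℝ} {G : (ℕ → ℝ) → ℕ → ℝ} {Cm θ γ β₀ bs ta gs e' : ℝ} {t : ℕ → ℝ} {a : ℕ → ℝ} {Λ : ℝ → ℝ}
    (hB : MemoryProfile Cm θ γ B) (hCm : 0 ≤ Cm) (hθ0 : 0 ≤ θ) (hθ1 : θ < 1) (hbs : 0 < bs) (hta : 0 < ta)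
    (hts : SeqBox γ t) (htf : MemFlow B gs t) (hprof : ∀ m : ℕ, 1 / ta ^ 2 + bs * (m : ℝ) ≤ 1 / (t m) ^ 2)
    (hG : ∀ u : ℕ → ℝ, SeqBox γ u → ∀ j, |G u j| ≤ Cm * θ ^ j)
    (hGB : ∀ ε > 0, ∃ ρ > 0, ∀ u u' : ℕ → ℝ, SeqBox γ u → SeqBox γ u' → (∀ j, |u' j - u j| ≤ ρ) →
      |B u' - B u - ∑' j, G u j * (u' j - u j)| ≤ ε * ∑' j, θ ^ j * |u' j - u j|)
    (hGc : ∀ ε > 0, ∃ ρ > 0, ∀ u u' : ℕ → ℝ, SeqBox γ u → SeqBox γ u' → (∀ j, |u' j - u j| ≤ ρ) → ∀ j, |G u' j - G u j| ≤ ε * θ ^ j)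
    (hΛ : ∀ e ∈ Ioc (0 : ℝ) e', ∀ h : ℕ → ℝ, SeqBox γ h → MemFlow B e h → Tendsto (fun n => 1 / h n ^ 2 - a n) atTop (𝓝 (Λ e)))
    (hanti : StrictAntiOn Λ (Ioc 0 e')) (honto : ∀ y : ℝ, Λ e' ≤ y → ∃ x ∈ Ioc (0 : ℝ) e', Λ x = y) (hβ₀ : 0 < β₀)
    (h2e' : 2 * e' ≤ γ) (hs1 : 4 * Cm * e' ≤ bs * (1 - θ))
    (hs2 : e' ^ 2 * (1 / gs ^ 2 + Cm * γ / (1 - θ) ^ 2 + (2 * Cm / ((1 - θ) * bs)) ^ 2) ≤ 3 / 4)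
    (hs4 : 64 * Cm * e' ^ 3 ≤ (1 - θ) ^ 2) (hs5 : Cm * (8 * e' ^ 3 + 16 * e' / bs) ≤ (1 - θ) / 4)
    {g : ℝ} (hg : g ∈ Ioc (0 : ℝ) e') :
    ContinuousOn (fun s : ℝ => β₀ / deriv Λ (invFunOn Λ (Ioc 0 e') (Λ g + s * β₀))) (Ioi 0) :=
  rg_velocity_continuousOn (D := deriv Λ) hanti honto hβ₀ (dynAbel_chart_bounds hB hCm hθ0 hθ1 hbs hta hts htf hprof hΛ h2e' hs1 hs2 hs4 hs5)
    (differentiableOn_dynAbel hB hCm hθ0 hθ1 hbs hta hts htf hprof hG hGB hΛ h2e' hs1 hs2 hs4 hs5).2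
    (deriv_dynAbel_continuousOn hB hCm hθ0 hθ1 hbs hta hts htf hprof hG hGB hGc hΛ h2e' hs1 hs2 hs4 hs5) hg

/-- **THE RUNNING COUPLING IS C¹ IN THE SCALE**: `s ↦ φ_s g ∈ C¹(]0, ∞[)` for every pin g of ]0, e′] (derivative `β₀∕Λ′(φ_s g)` at every s > 0, continuous by the above).
[cite: Balaban1987RG1, Thm 2 (0.31) p.259 with (0.20) p.256 and p.298] -/
theorem rg_contDiffOn_flow {B : (ℕ → ℝ) → ℝ} {G : (ℕ → ℝ) → ℕ → ℝ} {Cm θ γ β₀ bs ta gs e' : ℝ} {t : ℕ → ℝ} {a : ℕ → ℝ} {Λ : ℝ → ℝ}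
    (hB : MemoryProfile Cm θ γ B) (hCm : 0 ≤ Cm) (hθ0 : 0 ≤ θ) (hθ1 : θ < 1) (hbs : 0 < bs) (hta : 0 < ta)
    (hts : SeqBox γ t) (htf : MemFlow B gs t) (hprof : ∀ m : ℕ, 1 / ta ^ 2 + bs * (m : ℝ) ≤ 1 / (t m) ^ 2)
    (hG : ∀ u : ℕ → ℝ, SeqBox γ u → ∀ j, |G u j| ≤ Cm * θ ^ j)
    (hGB : ∀ ε > 0, ∃ ρ > 0, ∀ u u' : ℕ → ℝ, SeqBox γ u → SeqBox γ u' → (∀ j, |u' j - u j| ≤ ρ) →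
      |B u' - B u - ∑' j, G u j * (u' j - u j)| ≤ ε * ∑' j, θ ^ j * |u' j - u j|)
    (hGc : ∀ ε > 0, ∃ ρ > 0, ∀ u u' : ℕ → ℝ, SeqBox γ u → SeqBox γ u' → (∀ j, |u' j - u j| ≤ ρ) → ∀ j, |G u' j - G u j| ≤ ε * θ ^ j)
    (hΛ : ∀ e ∈ Ioc (0 : ℝ) e', ∀ h : ℕ → ℝ, SeqBox γ h → MemFlow B e h → Tendsto (fun n => 1 / h n ^ 2 - a n) atTop (𝓝 (Λ e)))
    (hanti : StrictAntiOn Λ (Ioc 0 e')) (honto : ∀ y : ℝ, Λ e' ≤ y → ∃ x ∈ Ioc (0 : ℝ) e', Λ x = y) (hβ₀ : 0 < β₀)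
    (h2e' : 2 * e' ≤ γ) (hs1 : 4 * Cm * e' ≤ bs * (1 - θ))
    (hs2 : e' ^ 2 * (1 / gs ^ 2 + Cm * γ / (1 - θ) ^ 2 + (2 * Cm / ((1 - θ) * bs)) ^ 2) ≤ 3 / 4)
    (hs4 : 64 * Cm * e' ^ 3 ≤ (1 - θ) ^ 2) (hs5 : Cm * (8 * e' ^ 3 + 16 * e' / bs) ≤ (1 - θ) / 4)
    {g : ℝ} (hg : g ∈ Ioc (0 : ℝ) e') :
    ContDiffOn ℝ 1 (fun s : ℝ => invFunOn Λ (Ioc 0 e') (Λ g + s * β₀)) (Ioi 0) := by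
  have hb := dynAbel_chart_bounds hB hCm hθ0 hθ1 hbs hta hts htf hprof hΛ h2e' hs1 hs2 hs4 hs5
  have hD := (differentiableOn_dynAbel hB hCm hθ0 hθ1 hbs hta hts htf hprof hG hGB hΛ h2e' hs1 hs2 hs4 hs5).2
  have hdiff := rg_differentiableOn (D := deriv Λ) hanti honto hβ₀ hb hD hg
  have hcont := rg_velocity_continuousOn_flow hB hCm hθ0 hθ1 hbs hta hts htf hprof hG hGB hGc hΛ hanti honto hβ₀ h2e' hs1 hs2 hs4 hs5 hg
  have he'mem : e' ∈ Ioc (0 : ℝ) e' := ⟨hg.1.trans_le hg.2, le_rfl⟩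
  have hΛg : Λ e' ≤ Λ g := hanti.antitoneOn hg he'mem hg.2
  -- the derivative in closed form at every s > 0
  have hderiv : ∀ s ∈ Ioi (0 : ℝ), deriv (fun σ : ℝ => invFunOn Λ (Ioc 0 e') (Λ g + σ * β₀)) s
      = β₀ / deriv Λ (invFunOn Λ (Ioc 0 e') (Λ g + s * β₀)) := by
    intro s hs
    have hgs : Λ e' < Λ g + s * β₀ := by have := mul_pos (mem_Ioi.1 hs) hβ₀; linarith
    exact rg_deriv_eq (D := deriv Λ) hanti honto hβ₀ hb hD hgs
  have h1 : ContDiffOn ℝ (((0 : ℕ) : WithTop ℕ∞) + 1) (fun σ : ℝ => invFunOn Λ (Ioc 0 e') (Λ g + σ * β₀)) (Ioi 0) := by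
    rw [contDiffOn_succ_iff_deriv_of_isOpen isOpen_Ioi]
    exact ⟨hdiff, fun h => by simp at h, contDiffOn_zero.2 (hcont.congr hderiv)⟩
  exact_mod_cast h1

/-- `|1∕(1+u) − 1| ≤ (4∕3)|u|` for `|u| ≤ 1∕4`. [folklore] -/
theorem abs_inv_one_add_sub_one_le {u : ℝ} (hu : |u| ≤ 1 / 4) : |1 / (1 + u) - 1| ≤ 4 / 3 * |u| := by
  obtain ⟨hlo, hhi⟩ := abs_le.mp hu
  have hpos : 0 < 1 + u := by linarith
  have h34 : 3 / 4 ≤ 1 + u := by linarith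
  rw [show 1 / (1 + u) - 1 = -u / (1 + u) by field_simp; ring, abs_div, abs_neg, abs_of_pos hpos, div_le_iff₀ hpos]
  nlinarith [abs_nonneg u]

/-- **A CONTINUOUS, ASYMPTOTICALLY FREE β-FUNCTION.**  Under part 14's package, the C¹ shape (`hG`, `hGB`, `hGc`) and part 44's interface, the β-function of the continuous
renormalization group **`β_c(x) := β₀ ∕ deriv Λ x`** is CONTINUOUS on ]0, e′[ and satisfies AT EVERY coupling x ∈ ]0, e′[:
**`|(−2∕(β₀x³))·β_c(x) − 1| ≤ (4∕3)·C_m(8x³ + 16x∕β*)∕(1−θ)`** — `β_c(x) = −(β₀∕2)x³(1 + O(x))`, the one-loop generator with a continuous remainder; by §123 it IS the velocity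
of the running coupling at every scale. [cite: Balaban1987RG1, Thm 2 (0.31) p.259 with (0.20) p.256 and p.298] -/
theorem betaFunction_continuous_oneLoop {B : (ℕ → ℝ) → ℝ} {G : (ℕ → ℝ) → ℕ → ℝ} {Cm θ γ β₀ bs ta gs e' : ℝ} {t : ℕ → ℝ} {a : ℕ → ℝ} {Λ : ℝ → ℝ}
    (hB : MemoryProfile Cm θ γ B) (hCm : 0 ≤ Cm) (hθ0 : 0 ≤ θ) (hθ1 : θ < 1) (hbs : 0 < bs) (hta : 0 < ta)
    (hts : SeqBox γ t) (htf : MemFlow B gs t) (hprof : ∀ m : ℕ, 1 / ta ^ 2 + bs * (m : ℝ) ≤ 1 / (t m) ^ 2)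
    (hG : ∀ u : ℕ → ℝ, SeqBox γ u → ∀ j, |G u j| ≤ Cm * θ ^ j)
    (hGB : ∀ ε > 0, ∃ ρ > 0, ∀ u u' : ℕ → ℝ, SeqBox γ u → SeqBox γ u' → (∀ j, |u' j - u j| ≤ ρ) →
      |B u' - B u - ∑' j, G u j * (u' j - u j)| ≤ ε * ∑' j, θ ^ j * |u' j - u j|)
    (hGc : ∀ ε > 0, ∃ ρ > 0, ∀ u u' : ℕ → ℝ, SeqBox γ u → SeqBox γ u' → (∀ j, |u' j - u j| ≤ ρ) → ∀ j, |G u' j - G u j| ≤ ε * θ ^ j)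
    (hΛ : ∀ e ∈ Ioc (0 : ℝ) e', ∀ h : ℕ → ℝ, SeqBox γ h → MemFlow B e h → Tendsto (fun n => 1 / h n ^ 2 - a n) atTop (𝓝 (Λ e)))
    (hβ₀ : 0 < β₀) (h2e' : 2 * e' ≤ γ) (hs1 : 4 * Cm * e' ≤ bs * (1 - θ))
    (hs2 : e' ^ 2 * (1 / gs ^ 2 + Cm * γ / (1 - θ) ^ 2 + (2 * Cm / ((1 - θ) * bs)) ^ 2) ≤ 3 / 4)
    (hs4 : 64 * Cm * e' ^ 3 ≤ (1 - θ) ^ 2) (hs5 : Cm * (8 * e' ^ 3 + 16 * e' / bs) ≤ (1 - θ) / 4) :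
    ContinuousOn (fun x : ℝ => β₀ / deriv Λ x) (Ioo 0 e') ∧
      ∀ x ∈ Ioo (0 : ℝ) e', β₀ / deriv Λ x < 0 ∧
        |-2 / (β₀ * x ^ 3) * (β₀ / deriv Λ x) - 1| ≤ 4 / 3 * (Cm * (8 * x ^ 3 + 16 * x / bs) / (1 - θ)) := by
  obtain ⟨-, hDc, hneg⟩ := smooth_hypotheses_of_flow hB hCm hθ0 hθ1 hbs hta hts htf hprof hG hGB hGc hΛ h2e' hs1 hs2 hs4 hs5
  refine ⟨continuousOn_const.div hDc fun x hx => (hneg x hx).ne, fun x hx => ⟨div_neg_of_pos_of_neg hβ₀ (hneg x hx), ?_⟩⟩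
  obtain ⟨-, hneg', hone, -⟩ := differentiableAt_dynAbel hB hCm hθ0 hθ1 hbs hta hts htf hprof hG hGB hΛ h2e' hs1 hs2 hs4 hs5 hx
  have h1θ : 0 < 1 - θ := by linarith
  have hγ : 0 ≤ γ := by linarith [hx.1, hx.2]
  -- the package at x bounds the defect by 1/4
  obtain ⟨-, -, -, hs5x⟩ := EriceFlowEnclosureB12AsPrintedHistoryContagionShiftFlowZeroOffset.package_of_le (gs := gs) hCm hθ1 hbs hγ hx.1 hx.2.le hs1 hs2 hs4 hs5
  have hK : Cm * (8 * x ^ 3 + 16 * x / bs) / (1 - θ) ≤ 1 / 4 := by rw [div_le_iff₀ h1θ]; linarith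
  set u : ℝ := (-(x ^ 3) / 2) * deriv Λ x - 1 with hu
  have hx3 : x ^ 3 ≠ 0 := pow_ne_zero 3 hx.1.ne'
  have hD0 : deriv Λ x ≠ 0 := (hneg x hx).ne
  have e1 : -2 / (β₀ * x ^ 3) * (β₀ / deriv Λ x) = 1 / (1 + u) := by
    have hne1 : β₀ * x ^ 3 * deriv Λ x ≠ 0 := mul_ne_zero (mul_ne_zero hβ₀.ne' hx3) hD0
    have hne2 : -(x ^ 3) / 2 * deriv Λ x ≠ 0 := mul_ne_zero (by simpa using hx3) hD0
    rw [hu, show 1 + (-(x ^ 3) / 2 * deriv Λ x - 1) = -(x ^ 3) / 2 * deriv Λ x by ring, div_mul_div_comm,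
      div_eq_div_iff hne1 hne2]
    ring
  rw [e1]
  exact (abs_inv_one_add_sub_one_le (hone.trans hK)).trans (mul_le_mul_of_nonneg_left hone (by norm_num))

end

end Summit.QuantumFields.BalabanUV.Beta.EriceFlowEnclosureB12AsPrintedHistoryContagionShiftFlowZeroTangentGellMannLow
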